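import Summits.Ventures.QEC.Census.BB.BB784Data
import Summits.Ventures.QEC.Census.BB.BB784RedX
import Summits.Ventures.QEC.Census.RankPivotChunks
import HarnessLib

/-!
# `[[784,24,≤24]]` (BB.bb784): `rank₂ H^X = 380`, chunked masks-only RREF certificate — part b (pivot columns, indices 0…191)

`BB.bb784` = `QC(x²⁶+y⁶+y⁸, y⁷+x⁹+x²⁰)` on `ℤ₂₈ × ℤ₁₄` [BravyiEtAl2024, §5] (arXiv:2308.07915 chunk p0011 L41–47); rows `BBRows.rowsX la lb`
and pivots `pivX` from `Census/BB/BB784Data.lean`, masks/reduced rows in chunks from `BB784RedX.lean`. Part a: every reduced row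
re-derived from its mask (`masksOKL`, four chunks of 95, `decide +kernel` each) and every check row re-assembled from its pivot bits
(`redSelL`). Parts b/c: unit pivot columns over index ranges (`List.range'` chunks, `decide +kernel` each); part c assembles
`pivotsOK` (`Census/RankPivotChunks.pivotsOK_of_forall`) and the rank (`Census/RankRREFAppend.rank_rowMatrix_of_parts`), transported to
`BB.bb784.HXFlat` along `rowsX_obj`. Tier KERNEL; axioms standard; no `native_decide`. HONEST FRAMING: a rank only.
-/

namespace Summit.Ventures.QEC.Census.BB784

open Matrix Literature.InformationTheory.QuantumCodes Summit.Ventures.QEC.Census BBRows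

/-- Pivot chunk 1: for indices `i ∈ [0, 48)`, pivot `pivX[i] < 784` and column `pivX[i]` of the reduced rows is the unit vector `e_i` (`decide +kernel`). -/
theorem pivXc1_ok : ((List.range' 0 48).all fun i => ((pivX.getD i 0 < 784 : Bool) && (colMask (rX1 ++ rX2 ++ rX3 ++ rX4) (pivX.getD i 0) == 2 ^ i))) = true := by
  decide +kernel

/-- Pivot chunk 2: for indices `i ∈ [48, 96)`, pivot `pivX[i] < 784` and column `pivX[i]` of the reduced rows is the unit vector `e_i` (`decide +kernel`). -/
theorem pivXc2_ok : ((List.range' 48 48).all fun i => ((pivX.getD i 0 < 784 : Bool) && (colMask (rX1 ++ rX2 ++ rX3 ++ rX4) (pivX.getD i 0) == 2 ^ i))) = true := by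
  decide +kernel

/-- Pivot chunk 3: for indices `i ∈ [96, 144)`, pivot `pivX[i] < 784` and column `pivX[i]` of the reduced rows is the unit vector `e_i` (`decide +kernel`). -/
theorem pivXc3_ok : ((List.range' 96 48).all fun i => ((pivX.getD i 0 < 784 : Bool) && (colMask (rX1 ++ rX2 ++ rX3 ++ rX4) (pivX.getD i 0) == 2 ^ i))) = true := by
  decide +kernel

/-- Pivot chunk 4: for indices `i ∈ [144, 192)`, pivot `pivX[i] < 784` and column `pivX[i]` of the reduced rows is the unit vector `e_i` (`decide +kernel`). -/
theorem pivXc4_ok : ((List.range' 144 48).all fun i => ((pivX.getD i 0 < 784 : Bool) && (colMask (rX1 ++ rX2 ++ rX3 ++ rX4) (pivX.getD i 0) == 2 ^ i))) = true := by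
  decide +kernel

end Summit.Ventures.QEC.Census.BB784
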